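/-
Copyright (c) 2026 the pub-hodgecm-mathlib formalisation cell (harness21).  Prover seat hodgecm-mathlib-LH4-p11 (g8), Track A «(D-RAM) FOUR-FRAME» squad, helper lane on
h413 = stmt-HodgeConjecture-24833 (count-neutral).  Heir dealer∕pen LH4-plan (g13) WORD #70 (2) ∕ #82 (B) ∕ #91; SPEC-B2 v1 3227ed60 (A_L) UNCONDITIONAL.  2026-09-04.
-/
import Summits.HodgeConjecture.HodgeConjecture.Theorems.F0P3cDyRamLabelledOddStageA                 -- ★ p860336 (this seat): (A_L) modulo the per-orbit identity
import Summits.HodgeConjecture.HodgeConjecture.Theorems.F0P3cDyRamDiagonalLabelledOddFibreCount    -- ★ (LH4-p10 (g6), B2a-2 FILE 3): `sum_sign_mul_finsum_ncard_fibre_sepAt_mul_relIndex_eq` (SIG dbcde430 token for token)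
import Summits.HodgeConjecture.HodgeConjecture.Theorems.F0P3cDyRamValueClassLabelEquivariant       -- ★ p860316 (this seat): `isTorusEquivariantLabel_valueClassLabel`
import HarnessLib

/-!
# Crux `H413`, line LH4 «(D-RAM) FOUR-FRAME» — (A_L) UNCONDITIONAL: the signed eightfold clean-shell class-`+` census IS `8 · Σᶠ_{M₀ ∈ 𝓛₀(T), shell} labelledOddCount ∕ [𝒰 : N S̃']`

Cell `hodgecm-mathlib` (D-0151), FLOOR 0, crux item H413 = `stmt-HodgeConjecture-24833`, route `HCCMUnconditional`; squad F0∕P3c∕LH4.  THEOREMS ONLY (no `def`, no instance,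
no notation, no `sorry`, default heartbeats); ★-only imports; lane `--supports stmt-HodgeConjecture-24833 --as helper` (count-neutral); pays NO row, states NO law.

WHY.  ★ p860336 gave (A_L) modulo the per-orbit fibre identity `hfib`; LH4-p10 (g6)'s ★ B2a-2 FILE 3 proves that identity for every `M₀` with finite unit-torus orbit and the
one-coset property at the vertex type, for any torus-equivariant label.  On `𝓛₀(T)` at type `0` both side conditions hold (★ `finite_unitTorus_orbit_of_mem_normalisedStableLattices`,
★ `fibre_isCoset_zero`), and the label of record is equivariant (★ `isTorusEquivariantLabel_valueClassLabel`).  Hence (A_L) with NO orbit hypothesis: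
* HEAD `cast_sum_sign_mul_ncard_shell_valueClass_eq_eight_mul_finsum` — `↑(Σ_e (−1)^{e_i}·#{M : type 0 for diag(d_e), T·M = M, shell, valueClassLabel … M d_e})
  = 8 · Σᶠ_{M₀ ∈ 𝓛₀(T), shell} labelledOddCount σ ϖ 0 i (valueClassLabel σ ϖ x₀ x₁ m d) M₀ ∕ [𝒰 : N(S̃'(M₀))]`.
* `sum_sign_mul_ncard_shell_valueClass_eq_zero_of_finsum_eq_zero` — the `h8` block of ★ p860156 (slot `i`) VANISHES as soon as the Stage-B finsum does: THIS is the socket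
  LH4-p05 (g8)'s END composes with the Stage-B table (F0P3-p01 (g36) B2b-1, LH4-p13 (g8) B2b-2, LH4-p14 (g6) B3, LH4-p05 B2b-3).
HONEST LABEL.  Count-neutral; the Stage-B finsum is a HYPOTHESIS; eightfold vanishing, (β-BAL), (β), T₊ OPEN; `HC_CM` is proved only modulo the 7 printed citations (2 remaining
named inputs: hLiu418 = `stmt-HodgeConjecture-24832`, h413 = `stmt-HodgeConjecture-24833`) until rung 0 closes.

## References
* [Kottwitz1986BaseChangeUnits] R. E. Kottwitz, *Base change for unit elements of Hecke algebras*, Compositio Math. 60 (1986), §1 pp. 240–241.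
* [Rogawski1990] J. D. Rogawski, *Automorphic Representations of Unitary Groups in Three Variables*, Ann. of Math. Stud. 123 (1990), §4.9 Prop. 4.9.1 (a)(b) p. 55, §4.10 p. 58.
* [LanglandsShelstad1987] R. P. Langlands, D. Shelstad, *On the definition of transfer factors*, Math. Ann. 278 (1987), §1.3, §3.
-/

set_option autoImplicit false

noncomputable section

namespace Summit.HodgeConjecture.HodgeConjecture.Cruxes.H413.F0P3cDyRamLabelledOddStageAOfRecord

open Literature.NumberTheory.Automorphic Literature.NumberTheory.Automorphic.HermitianLattice
open Literature.NumberTheory.Automorphic.UnitaryLatticeTree Literature.NumberTheory.Automorphic.UnitaryThreeFourFrame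
open Summit.HodgeConjecture.HodgeConjecture.Cruxes.H413.F0P3cDyRamFourFramePieces
open Summit.HodgeConjecture.HodgeConjecture.Cruxes.H413.F0P3cDyRamFourFrameCensusDefs
open Summit.HodgeConjecture.HodgeConjecture.Cruxes.H413.F0P3cDyRamDiagonalTorusDefs
open Summit.HodgeConjecture.HodgeConjecture.Cruxes.H413.F0P3cDyRamLabelledOddCountDefs
open Summit.HodgeConjecture.HodgeConjecture.Cruxes.H413.F0P3cDyRamDiagonalOrbitFibreTransport (fibre_isCoset_zero)
open Summit.HodgeConjecture.HodgeConjecture.Cruxes.H413.F0P3cDyRamDiagonalOrbitFibreCountHeads (finite_unitTorus_orbit_of_mem_normalisedStableLattices)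
open Summit.HodgeConjecture.HodgeConjecture.Cruxes.H413.F0P3cDyRamLabelledOddStageA
open Summit.HodgeConjecture.HodgeConjecture.Cruxes.H413.F0P3cDyRamDiagonalLabelledOddFibreCount (sum_sign_mul_finsum_ncard_fibre_sepAt_mul_relIndex_eq)
open Summit.HodgeConjecture.HodgeConjecture.Cruxes.H413.F0P3cDyRamValueClassLabelEquivariant (isTorusEquivariantLabel_valueClassLabel)
open scoped Valued WithZero Matrix MatrixGroups

variable {K : Type} [Field K] [Valued K ℤᵐ⁰] [Finite 𝓀[K]]

/-- **HEAD — (A_L) UNCONDITIONAL.**  `σ` an isometric involution, uniformiser `ϖ = ↑ϖu`, `u` a `σ`-fixed NON-NORM unit with the index-two dichotomy, `T = diag(s)` a regular unit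
diagonal, `X = diag(x₀, x₁, 0)`, shell levels `(ℓ, mc)`, label level `m`, depth letter `d`, slot `i`:
`↑(Σ_e (−1)^{e_i} · #{M : type 0 for diag(d_e), T·M = M, XM ⊆ ϖ^ℓM ⊄ ϖ^{ℓ+1}M, X²M ⊆ ϖ^{mc}M, valueClassLabel σ ϖ x₀ x₁ m d M d_e})
 = 8 · Σᶠ_{M₀ ∈ 𝓛₀(T), shell} labelledOddCount σ ϖ 0 i (valueClassLabel σ ϖ x₀ x₁ m d) M₀ ∕ [𝒰 : N(S̃'(M₀))]` — ★ p860336 with `hfib` := LH4-p10's ★ B2a-2 at type `0`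
(orbit finiteness ★, one-coset ★ `fibre_isCoset_zero`, equivariance ★). [cite: Kottwitz1986BaseChangeUnits, §1 pp. 240–241] [cite: Rogawski1990, §4.9 Prop. 4.9.1 (a)(b) p. 55, §4.10 p. 58] [cite: LanglandsShelstad1987, §3] -/
theorem cast_sum_sign_mul_ncard_shell_valueClass_eq_eight_mul_finsum {σ : K →+* K} (hσ : ∀ x, σ (σ x) = x)
    (hvσ : ∀ a, Valued.v (σ a) = Valued.v a) {ϖ : K} (hϖ : Valued.v ϖ = WithZero.exp (-1 : ℤ)) (ϖu : Kˣ) (hϖu : (ϖu : K) = ϖ)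
    {u : K} (hσu : σ u = u) (hvu : Valued.v u = 1) (hun : ¬ ∃ z : K, z * σ z = u)
    (hdich : ∀ x : K, σ x = x → x ≠ 0 → (∃ z : K, z * σ z = x) ∨ ∃ z : K, z * σ z = u * x)
    {s : Fin 3 → K} (hs : ∀ i, Valued.v (s i) = 1) (hreg : ∀ i j, i ≠ j → s i ≠ s j)
    (T : GL (Fin 3) K) (hT : (T : Matrix (Fin 3) (Fin 3) K) = Matrix.diagonal s) (x₀ x₁ : K) (ℓ mc m d : ℕ) (i : Fin 3) :
    (((∑ e : Fin 3 → Bool, (if e i then (-1 : ℤ) else 1) *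
        ({M : Submodule 𝒪[K] (Fin 3 → K) | IsVertexLattice σ ϖ (Matrix.diagonal fun j => if e j then u else (1 : K)) 0 M ∧ mapGL T M = M ∧
          ((LatticeInLevel ϖ ℓ (Matrix.diagonal ![x₀, x₁, 0]) M ∧ ¬ LatticeInLevel ϖ (ℓ + 1) (Matrix.diagonal ![x₀, x₁, 0]) M ∧
              LatticeInLevel ϖ mc (Matrix.diagonal ![x₀ * x₀, x₁ * x₁, 0]) M) ∧
            valueClassLabel σ ϖ x₀ x₁ m d M (fun j => if e j then u else (1 : K)))}.ncard : ℤ) : ℤ) : ℚ)) =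
      8 * ∑ᶠ M₀ ∈ {M | M ∈ normalisedStableLattices T ∧
          (LatticeInLevel ϖ ℓ (Matrix.diagonal ![x₀, x₁, 0]) M ∧ ¬ LatticeInLevel ϖ (ℓ + 1) (Matrix.diagonal ![x₀, x₁, 0]) M ∧
            LatticeInLevel ϖ mc (Matrix.diagonal ![x₀ * x₀, x₁ * x₁, 0]) M)},
        (labelledOddCount σ ϖ 0 i (valueClassLabel σ ϖ x₀ x₁ m d) M₀ : ℚ) /
          ((((unitStabilizer M₀).map (unitNormMap σ 3)).relIndex (fixedUnitTorus σ 3) : ℕ) : ℚ) := by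
  refine cast_sum_sign_mul_ncard_shell_valueClass_eq_eight_mul_finsum_of_fibre_identity hσ hvσ hϖ ϖu hϖu hσu hvu hun hdich hs hreg T hT x₀ x₁ ℓ mc m d i
    fun M₀ hM₀ _ => ?_
  obtain ⟨⟨g, hg⟩, -, hnorm⟩ := (mem_normalisedStableLattices_iff T M₀).1 hM₀
  exact sum_sign_mul_finsum_ncard_fibre_sepAt_mul_relIndex_eq hσ hvσ hϖ ϖu hϖu hσu hvu hun hdich
    (finite_unitTorus_orbit_of_mem_normalisedStableLattices hϖ hs hreg T hT hM₀) 0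
    (fun D₁ hD₁ hV₁ D hD => fibre_isCoset_zero hvσ ϖ g hg hnorm D₁ hD₁ hV₁ D hD)
    (valueClassLabel σ ϖ x₀ x₁ m d) (isTorusEquivariantLabel_valueClassLabel σ ϖ x₀ x₁ m d) i

/-- **THE `h8` BLOCK VANISHES ONCE THE STAGE-B FINSUM DOES — UNCONDITIONAL SOCKET.**  Same data; if `Σᶠ_{M₀ ∈ 𝓛₀(T), shell} labelledOddCount σ ϖ 0 i Λ M₀ ∕ [𝒰 : N S̃'(M₀)] = 0`
then the slot-`i` block of ★ p860156's `h8` (label written as `valueClassLabel`, = the `h8` text by `Iff.rfl`) is `0` in `ℤ`.  LH4-p05 (g8)'s END: `h8 := fun … i => this …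
(stageB_table … i)`. [cite: Kottwitz1986BaseChangeUnits, §1 pp. 240–241] [cite: LanglandsShelstad1987, §3] -/
theorem sum_sign_mul_ncard_shell_valueClass_eq_zero_of_finsum_eq_zero {σ : K →+* K} (hσ : ∀ x, σ (σ x) = x)
    (hvσ : ∀ a, Valued.v (σ a) = Valued.v a) {ϖ : K} (hϖ : Valued.v ϖ = WithZero.exp (-1 : ℤ)) (ϖu : Kˣ) (hϖu : (ϖu : K) = ϖ)
    {u : K} (hσu : σ u = u) (hvu : Valued.v u = 1) (hun : ¬ ∃ z : K, z * σ z = u)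
    (hdich : ∀ x : K, σ x = x → x ≠ 0 → (∃ z : K, z * σ z = x) ∨ ∃ z : K, z * σ z = u * x)
    {s : Fin 3 → K} (hs : ∀ i, Valued.v (s i) = 1) (hreg : ∀ i j, i ≠ j → s i ≠ s j)
    (T : GL (Fin 3) K) (hT : (T : Matrix (Fin 3) (Fin 3) K) = Matrix.diagonal s) (x₀ x₁ : K) (ℓ mc m d : ℕ) (i : Fin 3)
    (hB : ∑ᶠ M₀ ∈ {M | M ∈ normalisedStableLattices T ∧
          (LatticeInLevel ϖ ℓ (Matrix.diagonal ![x₀, x₁, 0]) M ∧ ¬ LatticeInLevel ϖ (ℓ + 1) (Matrix.diagonal ![x₀, x₁, 0]) M ∧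
            LatticeInLevel ϖ mc (Matrix.diagonal ![x₀ * x₀, x₁ * x₁, 0]) M)},
        (labelledOddCount σ ϖ 0 i (valueClassLabel σ ϖ x₀ x₁ m d) M₀ : ℚ) /
          ((((unitStabilizer M₀).map (unitNormMap σ 3)).relIndex (fixedUnitTorus σ 3) : ℕ) : ℚ) = 0) :
    (∑ e : Fin 3 → Bool, (if e i then (-1 : ℤ) else 1) *
        ({M : Submodule 𝒪[K] (Fin 3 → K) | IsVertexLattice σ ϖ (Matrix.diagonal fun j => if e j then u else (1 : K)) 0 M ∧ mapGL T M = M ∧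
          ((LatticeInLevel ϖ ℓ (Matrix.diagonal ![x₀, x₁, 0]) M ∧ ¬ LatticeInLevel ϖ (ℓ + 1) (Matrix.diagonal ![x₀, x₁, 0]) M ∧
              LatticeInLevel ϖ mc (Matrix.diagonal ![x₀ * x₀, x₁ * x₁, 0]) M) ∧
            valueClassLabel σ ϖ x₀ x₁ m d M (fun j => if e j then u else (1 : K)))}.ncard : ℤ)) = 0 := by
  have h := cast_sum_sign_mul_ncard_shell_valueClass_eq_eight_mul_finsum hσ hvσ hϖ ϖu hϖu hσu hvu hun hdich hs hreg T hT x₀ x₁ ℓ mc m d i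
  rw [hB, mul_zero] at h
  exact_mod_cast h

end Summit.HodgeConjecture.HodgeConjecture.Cruxes.H413.F0P3cDyRamLabelledOddStageAOfRecord

end
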